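import Literature.Probability.LatticeModels.AnisotropicInfraredConstantLog
import Literature.Probability.LatticeModels.GinibrePositiveKernels
import Literature.Probability.FitznerVanDerHofstad2017.SrwLawBesselEGF
import HarnessLib

/-!
# A kernel quadrature for Fröhlich–Israel–Lieb–Simon's constant of the layered dispersion:
# certified node values of `B(s) = 2πe^{−s}I₀(s)`, the monotone upper Riemann sum, and the tail

Topic `Literature/Probability/LatticeModels`, namespace `AnisotropicRotator` (companion of
`AnisotropicInfraredConstantBound.lean`, `BesselFactorLaplaceBounds.lean`, `AnisotropicInfraredConstantLog.lean`).
The object is Kennedy–Lieb–Shastry's `C(r) = (2π)⁻³∫d³p / (2 − cos p₁ − cos p₂ + r(1 − cos p₃))` ([KLS1988JSP] eq. (7),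
[FILS1978] (4.7); tree `AnisotropicRotator.klsConstant`) in its heat-kernel form
`C(r) = (2π)⁻³ ∫₀^∞ B(t)²B(rt) dt`, `B(s) = ∫_{-π}^{π} e^{−s(1−cos k)}dk` (`klsConstant_eq_integral`). The tree bounds it
in closed form (`klsConstant_le_log`: `C(r) ≤ 1 + (2π)⁻¹ln(1/r)`, slope exact, constant off by `≈ 0.45`). Here the
integral is made evaluable to a DECIMAL in the kernel (the evaluation at `r = 1/10` is the companion file
`KLSConstantTenth.lean`):

* `besselFactor_eq_twoPi_mul` — `B(s) = 2π e^{−s} I₀(s)` (the tree's `srwHeatKernel_eq_exp_neg_mul_besselI`), and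
  **`besselFactor_le_series`** — the certified node value: for `s ≥ 0`, `K, J ∈ ℕ` and `q ∈ [0,1)` with
  `(s/2)² ≤ q(K+1)²`, `B(s) ≤ 2π · [Σ_{k<K} a_k(s) + a_K(s)/(1 − q)] / Σ_{j<J} s^j/j!`, `a_k(s) = (s/2)^{2k}/(k!)²`
  (partial sum of `I₀` plus a geometric tail; `e^{−s} ≤ 1/Σ_{j<J}s^j/j!`) — a rational expression `norm_num` evaluates.
* `setIntegral_Ioc_le_upperSum` — **the monotone upper Riemann sum**: `t ↦ B(t)²B(rt)` is non-increasing
  (`besselFactor_antitone`), so over consecutive nodes `a = t₀ ≤ t₁ ≤ … ≤ T`,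
  `∫_{(a,T]} B²B_r ≤ Σ_i (t_{i+1} − t_i)·B(t_i)²B(rt_i)` (`upperSum`, a recursion over the node list).
* `tripleF_tail_le` — the tail beyond `T ≥ 1/r`: `∫_T^∞ B²B_r ≤ 4πq ρT^{−1/2} + (4πγ/3)ρ³T^{−3/2} + (2/3)KqρT^{−3/2} +
  (2/5)Kγρ³T^{−5/2}` with `q = √(2π)`, `γ = 21/10`, `K = (21/5)q + 441/100`, `ρ = r^{−1/2}` (the two-term forms
  `besselFactor_le_two_term`, `besselFactor_sq_le`, as in the tail piece of `klsConstant_le_log`).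
* `tripleF_le_of_node`, `upperSum_le_mul_upperSumPairs`, `besselFactor_le_of_two_term` — the plumbing that turns a list
  of certified node values into a bound on the upper sum (`upperSumPairs`, a closed rational expression).

Cell use (`pub/hubbard-tc`, MO-S3, G1′ comparison-model floors; cross-cell with `hubbard-cq`): the machinery of the kernel upgrade
(`KLSConstantTenth.lean`) of the certified-numerics grid `K5-FLOOR-ANISO.md` §C–S. Comparison model only; no material statement.

References: [KLS1988JSP] T. Kennedy, E. H. Lieb, B. S. Shastry, J. Stat. Phys. 53 (1988) 1019, eq. (7); [FILS1978]
J. Fröhlich, R. Israel, E. H. Lieb, B. Simon, Commun. Math. Phys. 62 (1978) 1, (4.7).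
-/

noncomputable section

open MeasureTheory Set Finset Real
open scoped BigOperators Nat

namespace Literature.Probability.LatticeModels

namespace AnisotropicRotator

/-! ### Certified node values of `B(s) = 2πe^{-s}I₀(s)` -/

section Series

/-- `Σ_{j<J} s^j/j! ≤ e^s` for `s ≥ 0`. [folklore] -/
private theorem sum_pow_div_factorial_le_exp {s : ℝ} (hs : 0 ≤ s) (J : ℕ) :
    ∑ j ∈ range J, s ^ j / (j ! : ℝ) ≤ Real.exp s :=
  sum_le_hasSum (range J) (fun j _ => by positivity) (hasSum_exp_real s)

/-- The ratio of consecutive terms of `I₀`: `a_{k+1}(s) = a_k(s)·(s/2)²/(k+1)²`. [folklore] -/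
private theorem besselITerm_zero_succ (s : ℝ) (k : ℕ) :
    besselITerm 0 s (k + 1) = besselITerm 0 s k * ((s / 2) ^ 2 / ((k : ℝ) + 1) ^ 2) := by
  simp only [besselITerm, Int.natAbs_zero, add_zero, Nat.factorial_succ, Nat.cast_mul, Nat.cast_succ]
  have hk : (0 : ℝ) < k ! := by positivity
  field_simp
  ring

/-- Geometric domination of the `I₀` terms beyond `K`: `a_{K+j}(s) ≤ a_K(s) q^j` once `(s/2)² ≤ q(K+1)²`. [folklore] -/
private theorem besselITerm_zero_add_le {s : ℝ} (hs : 0 ≤ s) (K : ℕ) {q : ℝ} (hq0 : 0 ≤ q)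
    (hq : (s / 2) ^ 2 ≤ q * ((K : ℝ) + 1) ^ 2) (j : ℕ) :
    besselITerm 0 s (K + j) ≤ besselITerm 0 s K * q ^ j := by
  induction j with
  | zero => simp
  | succ j ih =>
    rw [← add_assoc, besselITerm_zero_succ, pow_succ q j, ← mul_assoc]
    have hpos : (0 : ℝ) < (((K + j : ℕ) : ℝ) + 1) ^ 2 := by positivity
    have hKj : (s / 2) ^ 2 / (((K + j : ℕ) : ℝ) + 1) ^ 2 ≤ q := by
      rw [div_le_iff₀ hpos]
      calc (s / 2) ^ 2 ≤ q * ((K : ℝ) + 1) ^ 2 := hq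
        _ ≤ q * ((((K + j : ℕ) : ℝ)) + 1) ^ 2 := by
          apply mul_le_mul_of_nonneg_left _ hq0
          have : (K : ℝ) + 1 ≤ ((K + j : ℕ) : ℝ) + 1 := by push_cast; linarith [(Nat.cast_nonneg j : (0:ℝ) ≤ j)]
          exact pow_le_pow_left₀ (by positivity) this 2
    exact mul_le_mul ih hKj (by positivity) (mul_nonneg (besselITerm_nonneg hs 0 K) (pow_nonneg hq0 j))

/-- **`I₀(s)` by a partial sum plus a geometric tail**: for `s ≥ 0`, `0 ≤ q < 1`, `(s/2)² ≤ q(K+1)²`,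
`I₀(s) ≤ Σ_{k<K} a_k(s) + a_K(s)/(1 − q)`. [folklore] -/
private theorem besselI_zero_le_partialSum {s : ℝ} (hs : 0 ≤ s) (K : ℕ) {q : ℝ} (hq0 : 0 ≤ q) (hq1 : q < 1)
    (hq : (s / 2) ^ 2 ≤ q * ((K : ℝ) + 1) ^ 2) :
    besselI 0 s ≤ ∑ k ∈ range K, besselITerm 0 s k + besselITerm 0 s K / (1 - q) := by
  have hsum := summable_besselITerm 0 s
  have hgeo : HasSum (fun j : ℕ => besselITerm 0 s K * q ^ j) (besselITerm 0 s K / (1 - q)) := by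
    rw [div_eq_mul_inv]
    exact (hasSum_geometric_of_lt_one hq0 hq1).mul_left _
  have htail : ∑' j, besselITerm 0 s (j + K) ≤ besselITerm 0 s K / (1 - q) := by
    refine le_trans (Summable.tsum_le_tsum (fun j => ?_) ((summable_nat_add_iff K).2 hsum) hgeo.summable)
      (le_of_eq hgeo.tsum_eq)
    rw [add_comm]
    exact besselITerm_zero_add_le hs K hq0 hq j
  have hsplit : ∑ k ∈ range K, besselITerm 0 s k + ∑' j, besselITerm 0 s (j + K) = besselI 0 s :=
    hsum.sum_add_tsum_nat_add K
  linarith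

/-- **`B(s) = 2π e^{−s} I₀(s)`** (the tree's `q_s(0) = e^{-s}I₀(s)` for the continuous-time walk kernel, whose Fourier
form is `B(s)/(2π)`). [cite: FILS1978, (4.7)] -/
theorem besselFactor_eq_twoPi_mul (s : ℝ) : besselFactor s = 2 * π * (Real.exp (-s) * besselI 0 s) := by
  rw [← Literature.Probability.FitznerVanDerHofstad2017.srwHeatKernel_eq_exp_neg_mul_besselI]
  unfold besselFactor srwHeatKernel
  simp only [Int.cast_zero, mul_zero, Real.cos_zero, one_mul]
  field_simp

/-- **Certified node value of `B`**: for `s ≥ 0`, `1 ≤ J`, `0 ≤ q < 1` and `(s/2)² ≤ q(K+1)²`,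
`B(s) ≤ 2π · [Σ_{k<K} a_k(s) + a_K(s)/(1 − q)] / Σ_{j<J} s^j/j!` (`e^{−s} ≤ 1/Σ_{j<J}s^j/j!`). A rational expression
at rational `s`. [cite: FILS1978, (4.7)] -/
theorem besselFactor_le_series {s : ℝ} (hs : 0 ≤ s) (K J : ℕ) (hJ : 1 ≤ J) {q : ℝ} (hq0 : 0 ≤ q) (hq1 : q < 1)
    (hq : (s / 2) ^ 2 ≤ q * ((K : ℝ) + 1) ^ 2) :
    besselFactor s ≤ 2 * π * ((∑ k ∈ range K, besselITerm 0 s k + besselITerm 0 s K / (1 - q)) /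
      ∑ j ∈ range J, s ^ j / (j ! : ℝ)) := by
  rw [besselFactor_eq_twoPi_mul]
  refine mul_le_mul_of_nonneg_left ?_ (by positivity)
  have hE : ∑ j ∈ range J, s ^ j / (j ! : ℝ) ≤ Real.exp s := sum_pow_div_factorial_le_exp hs J
  have hE0 : 0 < ∑ j ∈ range J, s ^ j / (j ! : ℝ) := by
    calc (0 : ℝ) < 1 := one_pos
      _ = ∑ j ∈ range 1, s ^ j / (j ! : ℝ) := by simp
      _ ≤ ∑ j ∈ range J, s ^ j / (j ! : ℝ) :=
          sum_le_sum_of_subset_of_nonneg (range_mono hJ) (fun j _ _ => by positivity)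
  have hI0 : 0 ≤ besselI 0 s := besselI_nonneg hs 0
  rw [le_div_iff₀ hE0, Real.exp_neg]
  calc (Real.exp s)⁻¹ * besselI 0 s * ∑ j ∈ range J, s ^ j / (j ! : ℝ)
      ≤ (Real.exp s)⁻¹ * besselI 0 s * Real.exp s :=
        mul_le_mul_of_nonneg_left hE (mul_nonneg (inv_nonneg.2 (Real.exp_pos s).le) hI0)
    _ = besselI 0 s := by field_simp
    _ ≤ _ := besselI_zero_le_partialSum hs K hq0 hq1 hq

end Series

/-! ### The monotone upper Riemann sum -/

section Riemann

/-- The integrand `F_r(t) = B(t)²B(rt)` of the heat-kernel form of `C(r)`. [cite: FILS1978, (4.7)] -/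
def tripleF (r t : ℝ) : ℝ := besselFactor t * besselFactor t * besselFactor (t * r)

/-- `F_r ≥ 0`. [cite: FILS1978, (4.7)] -/
theorem tripleF_nonneg (r t : ℝ) : 0 ≤ tripleF r t := by
  unfold tripleF
  exact mul_nonneg (mul_nonneg (zero_le_besselFactor _) (zero_le_besselFactor _)) (zero_le_besselFactor _)

/-- `F_r` is non-increasing in `t` for `r ≥ 0`. [cite: FILS1978, (4.7)] -/
theorem tripleF_antitone {r : ℝ} (hr : 0 ≤ r) {a t : ℝ} (hat : a ≤ t) : tripleF r t ≤ tripleF r a := by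
  unfold tripleF
  have h1 := besselFactor_antitone hat
  have h2 : besselFactor (t * r) ≤ besselFactor (a * r) := besselFactor_antitone (mul_le_mul_of_nonneg_right hat hr)
  exact mul_le_mul (mul_le_mul h1 h1 (zero_le_besselFactor _) (zero_le_besselFactor _)) h2
    (zero_le_besselFactor _) (mul_nonneg (zero_le_besselFactor _) (zero_le_besselFactor _))

/-- Node bounds multiply: `B(t) ≤ 2πv`, `B(rt) ≤ 2πw` ⇒ `F_r(t) ≤ (2π)³ v²w`. [cite: FILS1978, (4.7)] -/
theorem tripleF_le_of_node {r t v w : ℝ} (hv : besselFactor t ≤ 2 * π * v) (hw : besselFactor (t * r) ≤ 2 * π * w) :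
    tripleF r t ≤ (2 * π) ^ 3 * (v ^ 2 * w) := by
  unfold tripleF
  have h0 := zero_le_besselFactor t
  have h0' := zero_le_besselFactor (t * r)
  have hv0 : 0 ≤ 2 * π * v := h0.trans hv
  calc besselFactor t * besselFactor t * besselFactor (t * r)
      ≤ (2 * π * v) * (2 * π * v) * (2 * π * w) :=
        mul_le_mul (mul_le_mul hv hv h0 hv0) hw h0' (mul_nonneg hv0 hv0)
    _ = (2 * π) ^ 3 * (v ^ 2 * w) := by ring

/-- One cell of the upper sum: `∫_{(a,b]} F_r ≤ (b − a)·F_r(a)` (`F_r` non-increasing). [cite: FILS1978, (4.7)] -/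
theorem setIntegral_Ioc_tripleF_le {r : ℝ} (hr : 0 ≤ r) {a b : ℝ} (hab : a ≤ b)
    (hI : IntegrableOn (tripleF r) (Ioc a b)) :
    ∫ t in Ioc a b, tripleF r t ≤ (b - a) * tripleF r a := by
  calc ∫ t in Ioc a b, tripleF r t ≤ ∫ _ in Ioc a b, tripleF r a :=
        setIntegral_mono_on hI (by exact integrableOn_const (by simp [Real.volume_Ioc]) ) measurableSet_Ioc
          fun t ht => tripleF_antitone hr ht.1.le
    _ = (b - a) * tripleF r a := by
        rw [setIntegral_const, Real.volume_real_Ioc_of_le hab, smul_eq_mul]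

/-- The **upper Riemann sum** of `F` over the consecutive nodes `a :: l` up to `T`:
`Σ_i (t_{i+1} − t_i)·F(t_i)` with `t_{last+1} = T`. [folklore] -/
def upperSum (F : ℝ → ℝ) (T : ℝ) : List ℝ → ℝ
  | [] => 0
  | [a] => (T - a) * F a
  | a :: b :: l => (b - a) * F a + upperSum F T (b :: l)

/-- Unfolding `upperSum` on a list with at least two nodes. [folklore] -/
@[simp] private theorem upperSum_cons_cons (F : ℝ → ℝ) (T a b : ℝ) (l : List ℝ) :
    upperSum F T (a :: b :: l) = (b - a) * F a + upperSum F T (b :: l) := rfl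

/-- Unfolding `upperSum` on a single node. [folklore] -/
@[simp] private theorem upperSum_singleton (F : ℝ → ℝ) (T a : ℝ) : upperSum F T [a] = (T - a) * F a := rfl

/-- **The monotone upper Riemann sum bounds the integral**: for `r ≥ 0`, nodes `0 ≤ a ≤ t₁ ≤ … ≤ t_n ≤ T`
(`List.IsChain`), `∫_{(a,T]} F_r ≤ upperSum F_r T (a :: l)`. [cite: FILS1978, (4.7)] -/
theorem setIntegral_Ioc_le_upperSum {r : ℝ} (hr : 0 ≤ r) {T : ℝ}
    (hI : IntegrableOn (tripleF r) (Ioi 0)) :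
    ∀ (l : List ℝ) (a : ℝ), 0 ≤ a → List.IsChain (· ≤ ·) (a :: l) → (∀ x ∈ a :: l, x ≤ T) →
      ∫ t in Ioc a T, tripleF r t ≤ upperSum (tripleF r) T (a :: l) := by
  intro l
  induction l with
  | nil =>
    intro a ha _ hT
    have haT : a ≤ T := hT a (by simp)
    rw [upperSum_singleton]
    exact setIntegral_Ioc_tripleF_le hr haT (hI.mono_set (Ioc_subset_Ioi_self.trans (Ioi_subset_Ioi ha)))
  | cons b l ih =>
    intro a ha hch hT
    obtain ⟨hab, hch'⟩ := List.isChain_cons_cons.1 hch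
    have hb : 0 ≤ b := ha.trans hab
    have hbT : b ≤ T := hT b (by simp)
    have hT' : ∀ x ∈ b :: l, x ≤ T := fun x hx => hT x (List.mem_cons_of_mem a hx)
    have hI1 : IntegrableOn (tripleF r) (Ioc a b) := hI.mono_set (Ioc_subset_Ioi_self.trans (Ioi_subset_Ioi ha))
    have hI2 : IntegrableOn (tripleF r) (Ioc b T) := hI.mono_set (Ioc_subset_Ioi_self.trans (Ioi_subset_Ioi hb))
    rw [upperSum_cons_cons, ← Ioc_union_Ioc_eq_Ioc hab hbT,
      setIntegral_union (Ioc_disjoint_Ioc.2 (by simp [hab, hbT])) measurableSet_Ioc hI1 hI2]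
    exact add_le_add (setIntegral_Ioc_tripleF_le hr hab hI1) (ih b hb hch' hT')

/-- The upper Riemann sum with the node VALUES replaced by node BOUNDS: for pairs `(t_i, u_i)`,
`Σ_i (t_{i+1} − t_i)·u_i` with `t_{last+1} = T`. [folklore] -/
def upperSumPairs (T : ℝ) : List (ℝ × ℝ) → ℝ
  | [] => 0
  | [p] => (T - p.1) * p.2
  | p :: p' :: l => (p'.1 - p.1) * p.2 + upperSumPairs T (p' :: l)

/-- Unfolding `upperSumPairs` on two or more pairs (elementary quadrature bookkeeping for the cited constant, proved here).
[cite: KLS1988JSP, eq. (7)] -/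
@[simp] theorem upperSumPairs_cons_cons (T : ℝ) (p p' : ℝ × ℝ) (l : List (ℝ × ℝ)) :
    upperSumPairs T (p :: p' :: l) = (p'.1 - p.1) * p.2 + upperSumPairs T (p' :: l) := rfl

/-- Unfolding `upperSumPairs` on one pair (elementary quadrature bookkeeping for the cited constant, proved here).
[cite: KLS1988JSP, eq. (7)] -/
@[simp] theorem upperSumPairs_singleton (T : ℝ) (p : ℝ × ℝ) : upperSumPairs T [p] = (T - p.1) * p.2 := rfl

/-- **Node bounds propagate to the upper sum**: if the nodes increase, stay below `T`, and
`F(t_i) ≤ c·u_i` at every node, then `upperSum F T (t_i) ≤ c · upperSumPairs T ((t_i, u_i))` (elementary quadrature step for the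
cited constant, proved here). [cite: KLS1988JSP, eq. (7)] -/
theorem upperSum_le_mul_upperSumPairs (F : ℝ → ℝ) (T c : ℝ) :
    ∀ l : List (ℝ × ℝ), List.IsChain (fun p p' => p.1 ≤ p'.1) l → (∀ p ∈ l, p.1 ≤ T) →
      (∀ p ∈ l, F p.1 ≤ c * p.2) → upperSum F T (l.map Prod.fst) ≤ c * upperSumPairs T l := by
  intro l
  induction l with
  | nil => intro _ _ _; simp [upperSum, upperSumPairs]
  | cons p l ih =>
    intro hch hT hF
    cases l with
    | nil =>
      simp only [List.map_cons, List.map_nil, upperSum_singleton, upperSumPairs_singleton]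
      have hpT : p.1 ≤ T := hT p (by simp)
      have hFp : F p.1 ≤ c * p.2 := hF p (by simp)
      nlinarith
    | cons p' l =>
      obtain ⟨hpp', hch'⟩ := List.isChain_cons_cons.1 hch
      simp only [List.map_cons, upperSum_cons_cons, upperSumPairs_cons_cons]
      have hFp : F p.1 ≤ c * p.2 := hF p (by simp)
      have ih' := ih hch' (fun x hx => hT x (List.mem_cons_of_mem p hx)) (fun x hx => hF x (List.mem_cons_of_mem p hx))
      simp only [List.map_cons] at ih'
      have h1 : (p'.1 - p.1) * F p.1 ≤ (p'.1 - p.1) * (c * p.2) := mul_le_mul_of_nonneg_left hFp (by linarith)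
      linarith

end Riemann

/-! ### The tail beyond `T` -/

section Tail

/-- `√(2π/t) = √(2π)·t^{-1/2}` for `t > 0`. [folklore] -/
private theorem sqrt_two_pi_div' {t : ℝ} (ht : 0 < t) :
    Real.sqrt (2 * π / t) = Real.sqrt (2 * π) * t ^ (-(1 / 2 : ℝ)) := by
  rw [Real.sqrt_div' _ ht.le, Real.sqrt_eq_rpow t, Real.rpow_neg ht.le, div_eq_mul_inv]

/-- `(t^{-1/2})ⁿ = t^{-n/2}` for `t > 0`. [folklore] -/
private theorem rpow_neg_half_pow' {t : ℝ} (ht : 0 < t) (n : ℕ) :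
    (t ^ (-(1 / 2 : ℝ))) ^ n = t ^ (-(n : ℝ) / 2) := by
  rw [← Real.rpow_natCast, ← Real.rpow_mul ht.le]
  congr 1
  ring

/-- **The tail of the heat-kernel integral beyond `T ≥ 1/r`** (`0 < r ≤ 1`): with `q = √(2π)`, `γ = 21/10`,
`K = (21/5)q + 441/100`, `ρ = r^{−1/2}`,
`∫_T^∞ B(t)²B(rt)dt ≤ 4πq·ρT^{−1/2} + (4πγ/3)·ρ³T^{−3/2} + (2/3)Kq·ρT^{−3/2} + (2/5)Kγ·ρ³T^{−5/2}`
(two-term forms of `B(rt)` and of `B(t)²`, valid since `t ≥ T ≥ 1/r ≥ 1`; the tail piece of `klsConstant_le_log`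
with a free cut-off). [cite: FILS1978, (4.7)] -/
theorem tripleF_tail_le {r T : ℝ} (hr : 0 < r) (hr1 : r ≤ 1) (hT : 1 / r ≤ T)
    (hI : IntegrableOn (tripleF r) (Ioi T)) :
    ∫ t in Ioi T, tripleF r t ≤
      4 * π * Real.sqrt (2 * π) * (r ^ (-(1 / 2 : ℝ)) * T ^ (-(1 / 2 : ℝ))) +
        4 * π * (21 / 10) / 3 * ((r ^ (-(1 / 2 : ℝ))) ^ 3 * T ^ (-(3 / 2 : ℝ))) +
        2 / 3 * (21 / 5 * Real.sqrt (2 * π) + 441 / 100) * Real.sqrt (2 * π) *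
          (r ^ (-(1 / 2 : ℝ)) * T ^ (-(3 / 2 : ℝ))) +
        2 / 5 * (21 / 5 * Real.sqrt (2 * π) + 441 / 100) * (21 / 10) *
          ((r ^ (-(1 / 2 : ℝ))) ^ 3 * T ^ (-(5 / 2 : ℝ))) := by
  set q : ℝ := Real.sqrt (2 * π) with hq
  set γ : ℝ := 21 / 10 with hγ
  set K : ℝ := 21 / 5 * q + 441 / 100 with hK
  have hR1 : 1 ≤ 1 / r := by rw [le_div_iff₀ hr]; linarith
  have hT1 : 1 ≤ T := hR1.trans hT
  have hT0 : 0 < T := by linarith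
  have hπ := Real.pi_pos
  have hq0 : 0 ≤ q := Real.sqrt_nonneg _
  have hK0 : 0 ≤ K := by positivity
  set ρ : ℝ := r ^ (-(1 / 2 : ℝ)) with hρ
  have hρ0 : 0 < ρ := Real.rpow_pos_of_pos hr _
  -- pointwise
  have hb3 : ∀ t ∈ Ioi T, tripleF r t ≤
      2 * π * q * ρ * t ^ (-(3 / 2 : ℝ)) + 2 * π * γ * ρ ^ 3 * t ^ (-(5 / 2 : ℝ)) +
        K * q * ρ * t ^ (-(5 / 2 : ℝ)) + K * γ * ρ ^ 3 * t ^ (-(7 / 2 : ℝ)) := by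
    intro t ht
    have ht1 : 1 ≤ t := le_trans hT1 (le_of_lt ht)
    have ht0 : 0 < t := lt_of_lt_of_le one_pos ht1
    have hu1 : 1 ≤ t * r := by
      have h := mul_le_mul_of_nonneg_right (le_of_lt (lt_of_le_of_lt hT ht)) hr.le
      rwa [one_div, inv_mul_cancel₀ hr.ne'] at h
    have hu0 : 0 < t * r := mul_pos ht0 hr
    set x : ℝ := t ^ (-(1 / 2 : ℝ)) with hx
    have hx0 : 0 ≤ x := Real.rpow_nonneg ht0.le _
    have hx1 : x ≤ 1 := Real.rpow_le_one_of_one_le_of_nonpos ht1 (by norm_num)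
    have hsq := besselFactor_sq_le ht1
    rw [← hq] at hsq
    have hx2 : t ^ (-(1 : ℝ)) = x ^ 2 := by rw [hx, rpow_neg_half_pow' ht0 2]; norm_num
    have hx4 : t ^ (-(2 : ℝ)) = x ^ 4 := by rw [hx, rpow_neg_half_pow' ht0 4]; norm_num
    have hx6 : t ^ (-(3 : ℝ)) = x ^ 6 := by rw [hx, rpow_neg_half_pow' ht0 6]; norm_num
    rw [hx2, hx4, hx6] at hsq
    have hx64 : x ^ 6 ≤ x ^ 4 := by
      have h6 : x ^ 6 = x ^ 4 * x ^ 2 := by ring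
      rw [h6]
      exact mul_le_of_le_one_right (by positivity) (pow_le_one₀ hx0 hx1)
    have hsq' : besselFactor t * besselFactor t ≤ 2 * π * x ^ 2 + K * x ^ 4 := by
      have hKx : K * x ^ 4 = 21 / 5 * q * x ^ 4 + 441 / 100 * x ^ 4 := by rw [hK]; ring
      rw [hKx]
      linarith only [hsq, hx64]
    have hBu := besselFactor_le_two_term hu1
    have hxu : (t * r) ^ (-(1 / 2 : ℝ)) = ρ * x := by
      rw [Real.mul_rpow ht0.le hr.le, hρ, hx]; ring
    have hBu' : besselFactor (t * r) ≤ q * ρ * x + γ * ρ ^ 3 * x ^ 3 := by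
      rw [sqrt_two_pi_div' hu0, hxu] at hBu
      have h3 : (t * r) ^ (-(3 / 2 : ℝ)) = (ρ * x) ^ 3 := by
        rw [← hxu, rpow_neg_half_pow' hu0 3]; norm_num
      rw [h3] at hBu
      calc besselFactor (t * r) ≤ Real.sqrt (2 * π) * (ρ * x) + 21 / 10 * (ρ * x) ^ 3 := hBu
        _ = q * ρ * x + γ * ρ ^ 3 * x ^ 3 := by rw [hq, hγ]; ring
    have hB0 := zero_le_besselFactor (t * r)
    have hMpos : 0 ≤ 2 * π * x ^ 2 + K * x ^ 4 := by positivity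
    have hstep : tripleF r t ≤ (2 * π * x ^ 2 + K * x ^ 4) * (q * ρ * x + γ * ρ ^ 3 * x ^ 3) := by
      unfold tripleF
      exact mul_le_mul hsq' hBu' hB0 hMpos
    have hx3 : t ^ (-(3 / 2 : ℝ)) = x ^ 3 := by rw [hx, rpow_neg_half_pow' ht0 3]; norm_num
    have hx5 : t ^ (-(5 / 2 : ℝ)) = x ^ 5 := by rw [hx, rpow_neg_half_pow' ht0 5]; norm_num
    have hx7 : t ^ (-(7 / 2 : ℝ)) = x ^ 7 := by rw [hx, rpow_neg_half_pow' ht0 7]; norm_num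
    rw [hx3, hx5, hx7]
    calc tripleF r t ≤ (2 * π * x ^ 2 + K * x ^ 4) * (q * ρ * x + γ * ρ ^ 3 * x ^ 3) := hstep
      _ = 2 * π * q * ρ * x ^ 3 + 2 * π * γ * ρ ^ 3 * x ^ 5 + K * q * ρ * x ^ 5 +
            K * γ * ρ ^ 3 * x ^ 7 := by ring
  -- integrals
  have hi : ∀ a : ℝ, a < -1 → IntegrableOn (fun t : ℝ => t ^ a) (Ioi T) := fun a ha =>
    integrableOn_Ioi_rpow_of_lt ha hT0
  have hv : ∀ a : ℝ, a < -1 → ∫ t in Ioi T, t ^ a = -T ^ (a + 1) / (a + 1) := fun a ha =>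
    integral_Ioi_rpow_of_lt ha hT0
  have h32 := hi (-(3 / 2 : ℝ)) (by norm_num)
  have h52 := hi (-(5 / 2 : ℝ)) (by norm_num)
  have h72 := hi (-(7 / 2 : ℝ)) (by norm_num)
  have hA1 : IntegrableOn (fun t : ℝ => 2 * π * q * ρ * t ^ (-(3 / 2 : ℝ))) (Ioi T) :=
    h32.const_mul _
  have hA2 : IntegrableOn (fun t : ℝ => 2 * π * q * ρ * t ^ (-(3 / 2 : ℝ)) +
      2 * π * γ * ρ ^ 3 * t ^ (-(5 / 2 : ℝ))) (Ioi T) := hA1.add (h52.const_mul _)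
  have hA3 : IntegrableOn (fun t : ℝ => 2 * π * q * ρ * t ^ (-(3 / 2 : ℝ)) +
      2 * π * γ * ρ ^ 3 * t ^ (-(5 / 2 : ℝ)) + K * q * ρ * t ^ (-(5 / 2 : ℝ))) (Ioi T) :=
    hA2.add (h52.const_mul _)
  have hA4 : IntegrableOn (fun t : ℝ => 2 * π * q * ρ * t ^ (-(3 / 2 : ℝ)) +
      2 * π * γ * ρ ^ 3 * t ^ (-(5 / 2 : ℝ)) + K * q * ρ * t ^ (-(5 / 2 : ℝ)) +
      K * γ * ρ ^ 3 * t ^ (-(7 / 2 : ℝ))) (Ioi T) := hA3.add (h72.const_mul _)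
  have hval : ∫ t in Ioi T, (2 * π * q * ρ * t ^ (-(3 / 2 : ℝ)) +
      2 * π * γ * ρ ^ 3 * t ^ (-(5 / 2 : ℝ)) + K * q * ρ * t ^ (-(5 / 2 : ℝ)) +
      K * γ * ρ ^ 3 * t ^ (-(7 / 2 : ℝ))) =
      2 * π * q * ρ * (-T ^ (-(3 / 2 : ℝ) + 1) / (-(3 / 2 : ℝ) + 1)) +
        2 * π * γ * ρ ^ 3 * (-T ^ (-(5 / 2 : ℝ) + 1) / (-(5 / 2 : ℝ) + 1)) +
        K * q * ρ * (-T ^ (-(5 / 2 : ℝ) + 1) / (-(5 / 2 : ℝ) + 1)) +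
        K * γ * ρ ^ 3 * (-T ^ (-(7 / 2 : ℝ) + 1) / (-(7 / 2 : ℝ) + 1)) := by
    rw [integral_add hA3 (h72.const_mul _), integral_add hA2 (h52.const_mul _),
      integral_add hA1 (h52.const_mul _),
      integral_const_mul, integral_const_mul, integral_const_mul, integral_const_mul,
      hv _ (by norm_num), hv _ (by norm_num), hv _ (by norm_num)]
  have hE1 : -(3 / 2 : ℝ) + 1 = -(1 / 2 : ℝ) := by norm_num
  have hE2 : -(5 / 2 : ℝ) + 1 = -(3 / 2 : ℝ) := by norm_num
  have hE3 : -(7 / 2 : ℝ) + 1 = -(5 / 2 : ℝ) := by norm_num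
  calc ∫ t in Ioi T, tripleF r t ≤ ∫ t in Ioi T, (2 * π * q * ρ * t ^ (-(3 / 2 : ℝ)) +
      2 * π * γ * ρ ^ 3 * t ^ (-(5 / 2 : ℝ)) + K * q * ρ * t ^ (-(5 / 2 : ℝ)) +
      K * γ * ρ ^ 3 * t ^ (-(7 / 2 : ℝ))) := setIntegral_mono_on hI hA4 measurableSet_Ioi hb3
    _ = _ := hval
    _ = 4 * π * q * (ρ * T ^ (-(1 / 2 : ℝ))) + 4 * π * γ / 3 * (ρ ^ 3 * T ^ (-(3 / 2 : ℝ))) +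
          2 / 3 * K * q * (ρ * T ^ (-(3 / 2 : ℝ))) +
          2 / 5 * K * γ * (ρ ^ 3 * T ^ (-(5 / 2 : ℝ))) := by
        rw [hE1, hE2, hE3]
        ring
    _ = _ := by rw [hK, hγ]

/-- **Certified node value of `B` from the two-term form** (`s ≥ 1`): with rationals `a, b, v ≥ 0` such that
`2·3.141593 ≤ s a²` (so `√(2π/s) ≤ a`), `b² ≤ s`, `0 < b` (so `s^{−3/2} ≤ 1/(sb)`) and `a + (21/10)/(sb) ≤ 2·3.141592·v`:
`B(s) ≤ 2πv`. [cite: FILS1978, (4.7)] -/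
theorem besselFactor_le_of_two_term {s a b v : ℝ} (hs : 1 ≤ s) (ha : 0 ≤ a) (hb : 0 < b) (hv : 0 ≤ v)
    (h1 : 2 * 3.141593 ≤ s * a ^ 2) (h2 : b ^ 2 ≤ s) (h3 : a + 21 / 10 / (s * b) ≤ 2 * 3.141592 * v) :
    besselFactor s ≤ 2 * π * v := by
  have hs0 : 0 < s := by linarith
  have hπlo := Real.pi_gt_d6
  have hπhi := Real.pi_lt_d6
  have hπ0 := Real.pi_pos
  -- `√(2π/s) ≤ a`
  have hsq : Real.sqrt (2 * π / s) ≤ a := by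
    rw [← Real.sqrt_sq ha]
    refine Real.sqrt_le_sqrt ?_
    rw [div_le_iff₀ hs0]
    nlinarith
  -- `s^{-3/2} ≤ 1/(s b)`
  have hsb : 0 < s * b := mul_pos hs0 hb
  have hroot : b ≤ Real.sqrt s := by
    rw [← Real.sqrt_sq hb.le]
    exact Real.sqrt_le_sqrt h2
  have hpow : s ^ (-(3 / 2 : ℝ)) ≤ 1 / (s * b) := by
    have h32 : s ^ ((3 / 2 : ℝ)) = s * Real.sqrt s := by
      rw [show (3 / 2 : ℝ) = 1 + 1 / 2 by norm_num, Real.rpow_add hs0, Real.rpow_one, Real.sqrt_eq_rpow]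
    rw [Real.rpow_neg hs0.le, h32, one_div]
    exact inv_anti₀ hsb (mul_le_mul_of_nonneg_left hroot hs0.le)
  have hB := besselFactor_le_two_term hs
  calc besselFactor s ≤ Real.sqrt (2 * π / s) + 21 / 10 * s ^ (-(3 / 2 : ℝ)) := hB
    _ ≤ a + 21 / 10 * (1 / (s * b)) := add_le_add hsq (mul_le_mul_of_nonneg_left hpow (by norm_num))
    _ = a + 21 / 10 / (s * b) := by ring
    _ ≤ 2 * 3.141592 * v := h3
    _ ≤ 2 * π * v := by nlinarith

end Tail

end AnisotropicRotator

end Literature.Probability.LatticeModels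

end
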